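import Summits.ABC.IUTFork.LDHGenuinePerImageContentfulTameSix
import Summits.ABC.IUTFork.LDHGenuinePerImageSufficiencyPoint
import Literature.IUT.LogVolume.GenuineTowerDegreeBounds
import Literature.IUT.LogVolume.LocalDegreeGlobalBounds
import HarnessLib

/-!
# The fork at [IUTchIII] Corollary 3.12, L-DH level, READING (P): the NECESSITY half at EVERY datum — the (P)-line crux
# forces Szpiro's inequality with constant `→ 6` and an additive term polynomial in `l` (abc-iut cell, crux ThetaPartII =
# stmt-ABC-19678, stub `stub_cor312PerImage`); ERRATUM for this lineage's «tame data» theorems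

Record-only PROOF file (D-0012) of the abc-iut cell (WAVE-3 discharge seat abc-iut-c312-d1, gen 7; row «P-CRUX-SUFFICIENCY», part E);
TAKES NO SIDE on [IUTchIII] Cor. 3.12 or on the (U)/(P) readings.

ERRATUM (finding F-c312-d1-g7-1, this lineage's own gen-6 files `LDHGenuinePerImageContentfulTame` p437558 /
`…TameSix` p437841): their hypothesis `htame : ∀ p ∈ T(I), ∀ v, ¬ p − 2 < e(K_{v̲}/ℚ_p)` is UNSATISFIABLE AS TYPED — `2 ∈ T(I)` always
(`ThetaVolumeInput.two_mem_supportPrimes`) and `e ≥ 1 > 0 = 2 − 2` (`absRamificationIdx_pos`); likewise at `3`, `5` (`E[15] ⊆ E(F)`) and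
at `l` (`μ_l ⊆ K`). So `hullEstimatePerImageOf_tame`, `szpiro_of_cor312PerImageAtDatum_tame(_linear/_six)` are VACUOUS (true, about no
datum), and the «tame data: constant → 6» sentences of CRUX-CONTENT v2/v3 (evidence #29/#35 on stmt-ABC-19678) describe an empty class.
THIS FILE REPLACES THEM by theorems about EVERY datum: abc-iut-S7's explicit per-image Step (v) estimate
(`DHData.hullEstimatePerImageOf_ofInput_explicit`, (R4)-shape hypothesis with a prime cut-off `N` and a log-ramification bound `lmod`) is
invoked with `N := E + 2`, `lmod := (3 + log E)/4` for ANY bound `E` of the ramification indices `e(K_{v̲}/ℚ_p)` over the support primes —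
the wild slots then cost `(20/3)·lmod·#{p ∈ T(I) : p ≤ E + 2} ≤ (5/3)·(3 + log E)·(E + 3)`, an ADDITIVE term — and `E` is then
instantiated by the kernel degree bound `e(K_{v̲}/ℚ_p) ≤ [K : ℚ] ≤ 184320·[F_tpd : ℚ]·l⁴` (abc-iut-w5-d194 `finrank_rat_K_le`, abc-iut-w6-d105
`absRamificationIdx_rescaledCompletion_le_finrank_rat`; [IUTchIV] Thm. 1.10 Step (ii)):

* `PointDict.hullEstimatePerImageOf_ofRamBound` — (ii′-P) at every datum whose support ramification is `≤ E`, with constant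
  `(l+1)/4·{(1+4/l)·(L + 2 log l + 21) + (4/l)·(2 d_mod L + log 30l) + (5/3)·(3 + log E)·(E + 3)}`, `L = log-diff + log 𝔣^{∤2l}`;
* `PointDict.ramBound_of_datum` — every datum has support ramification `≤ 184320·[F_tpd:ℚ]·l⁴`;
* **`PointDict.szpiro_of_cor312PerImageAtDatum_six_all`** — for `P ∈ UP`, a prime `l ≥ 7` and ANY genuine datum `T` at `(P, l)`:
  `Cor312PerImageAtDatum P l ⟹ (1/6 − 2/(l(l+1)))·log q^{∤2l}(λ) ≤ (1 + (4 + 8 d_mod)/l)·L + 5 log l + 46 + 2 log π + (5/3)·(3 + log E₀)·(E₀ + 3)`,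
  `E₀ = 184320·[F_tpd:ℚ]·l⁴` — Szpiro with constant `(1 + (4+8d_mod)/l)/(1/6 − 2/(l(l+1))) ↓ 6` and an additive term POLYNOMIAL IN `l`
  (print's display has the same shape: `(1 + 20 d_mod/l)·L + 20·(d*_mod·l + η)`, [IUTchIV] Thm. 1.10 p. 22–23);
* **`Cor22.cor312PerImageAtDatum_sandwich_dmod_one_all`** — the non-vacuous SANDWICH at `d_mod = 1` with part B's sufficiency (p446147):
  Szpiro(`6l(l+1)/((l+4)(l−3))`) ⟹ (P)-crux ⟹ [at any datum] Szpiro(`(1+12/l)/(1/6 − 2/(l(l+1)))`), both constants `↓ 6`.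

Nothing here asserts `Cor312PerImageAtDatum` for any point or the existence of data (data exist at admissible `(P,l)`: abc-iut-L5-t7's
`ThetaPartII.stub_thetaData`); no side taken. [cite: Mochizuki2012, IUTchIII Cor. 3.12 p. 173–174; IUTchIV Thm. 1.10 p. 22–23, proof Steps
(ii)–(viii) p. 24–31] [claim: Mochizuki2012, status: disputed] for every IUT quotation. PROOF-ONLY: no definitions, no new `Prop`; typed ≠ proved.
-/

noncomputable section

namespace Summit.ABC.IUTFork

open Literature.IUT.HodgeTheaters Literature.IUT.LogVolume NumberField IsDedekindDomain
open Literature.NumberTheory.DiophantineGeometry.GenEll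
open scoped Nat.Prime

namespace PointDict

variable {P : NFPoint} {l : ℕ}

/-- **The per-image hull estimate at a datum with support ramification `≤ E`** — reading (P), `λ ∈ U_P` minimally presented, `l ≥ 7`:
`T.HullEstimatePerImageOf ((l+1)/4·{(1+4/l)·(L + 2·log l + 21) + (4/l)·(2·d_mod·L + log(30·l)) + (20/3)·((3 + log E)/4)·(E + 3)})` — abc-iut-S7's
explicit per-image Step (v) constant at `N := E + 2`, `lmod := (3 + log E)/4` (every «wild» slot `e > p − 2` has `p ≤ E + 2` and
`3 + log e ≤ 3 + log E`; `#{p ∈ T(I) : p ≤ E + 2} ≤ E + 3`), with the pinned Step (ii)/(iii) tower bounds. Non-vacuous for `E ≥ [K:ℚ]`.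
[cite: Mochizuki2012, IUTchIV Thm. 1.10 proof Steps (ii)–(v) p. 24–29] [claim: Mochizuki2012, status: disputed] -/
theorem hullEstimatePerImageOf_ofRamBound (T : Cor22.ThetaVolumeDatumAt P l) (hP : P ∈ UP) (h7 : 7 ≤ l) (E : ℕ) (hE1 : 1 ≤ E)
    (hE : letI := T.instFieldF; letI := T.instNumberFieldF; letI := T.instAlgebraF; letI := T.instFieldK
      letI := T.instNumberFieldK; letI := T.instAlgebraK; letI := T.instIsElliptic
      ∀ (p : ℕ) [hp : Fact p.Prime], p ∈ T.I.supportPrimes → ∀ v : placesOver (fieldOfModuli T.E) p,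
        absRamificationIdx p ((T.I.σ.localFieldFamily p hp.out).k v) ≤ E) :
    T.HullEstimatePerImageOf (((l : ℝ) + 1) / 4 *
      ((1 + 4 / (l : ℝ)) * (P.logDiff + Cor22.logCondAvoid P {2, l} + 2 * Real.log l + 21)
        + 4 / (l : ℝ) * (2 * (Cor22.dmod P : ℝ) * (P.logDiff + Cor22.logCondAvoid P {2, l}) + Real.log (2 * 3 * 5 * (l : ℝ)))
        + 20 / 3 * ((3 + Real.log E) / 4) * ((E : ℝ) + 3))) := by
  classical
  letI := T.instFieldF; letI := T.instNumberFieldF; letI := T.instAlgebraF; letI := T.instFieldK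
  letI := T.instNumberFieldK; letI := T.instAlgebraK; letI := T.instFieldFbar; letI := T.instAlgebraFbar
  letI := T.instAlgebraKFbar; letI := T.instIsElliptic
  have hU : P.InU := hP.1
  have hXl : ((T.I.X.l : ℕ) : ℝ) = (l : ℝ) := by exact_mod_cast T.isVolumeInputOf.l_eq
  haveI : IsGalois (fieldOfModuli T.E) T.K := T.isGalois_fieldOfModuli_K
  have hprimes : ∀ p ∈ T.I.supportPrimes, p.Prime := fun p hp => T.I.prime_of_mem_supportPrimes hp
  have hE1R : (1 : ℝ) ≤ E := by exact_mod_cast hE1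
  have hlogE : 0 ≤ Real.log E := Real.log_nonneg hE1R
  have hlmod : (0 : ℝ) ≤ (3 + Real.log E) / 4 := by positivity
  -- abc-iut-S7's per-image Step (v) estimate with cut-off `N := E + 2` and `lmod := (3 + log E)/4`
  have h0 := DHData.hullEstimatePerImageOf_ofInput_explicit T.I (E + 2) hlmod
    (fun p hp hmem v hv => by
      have he := hE p hmem v
      have he1 : 1 ≤ absRamificationIdx p ((T.I.σ.localFieldFamily p hp.out).k v) := absRamificationIdx_pos p _
      refine ⟨by omega, ?_⟩
      have hlog : Real.log (absRamificationIdx p ((T.I.σ.localFieldFamily p hp.out).k v) : ℝ) ≤ Real.log E :=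
        Real.log_le_log (by exact_mod_cast he1) (by exact_mod_cast he)
      linarith)
  rw [hXl] at h0
  -- Step (ii): `A ≤ log 𝔡^K ≤ L + 2·log l + 21`
  have hA1 := sum_dite_localDegree_mul_differentOrd_le_ndeg (fieldOfModuli T.E) T.K T.I.σ T.I.supportPrimes hprimes
  have hA2 := T.ndeg_differentDivisor_le hU h7
  have hA : (∑ p ∈ T.I.supportPrimes, if hp : p.Prime then haveI : Fact p.Prime := ⟨hp⟩
        (∑ v : placesOver (fieldOfModuli T.E) p, (localDegree (fieldOfModuli T.E) v.1 : ℝ) *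
          differentOrd p ((T.I.σ.localFieldFamily p hp).k v)) / Module.finrank ℚ (fieldOfModuli T.E) * Real.log p
        else 0) ≤ P.logDiff + Cor22.logCondAvoid P {2, l} + 2 * Real.log l + 21 := hA1.trans hA2
  -- Step (iii): `B ≤ 2·d_mod·L + log(30·l)`
  have hB := T.sum_log_supportPrimes_le_pinned hP
  -- the prime cut-off: `#{p ∈ T(I) : p ≤ E + 2} ≤ E + 3`
  have hcard : (((T.I.supportPrimes.filter (· ≤ E + 2)).card : ℕ) : ℝ) ≤ (E : ℝ) + 3 := by
    have h1 : (T.I.supportPrimes.filter (· ≤ E + 2)).card ≤ (Finset.Iic (E + 2)).card :=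
      Finset.card_le_card fun p hp => Finset.mem_Iic.2 (Finset.mem_filter.1 hp).2
    rw [Nat.card_Iic] at h1
    exact_mod_cast h1
  refine hullEstimatePerImageOf_mono T h0 ?_
  have hc0 : (0 : ℝ) ≤ ((l : ℝ) + 1) / 4 := by positivity
  have hl0 : (0 : ℝ) < l := by exact_mod_cast (lt_of_lt_of_le (by norm_num) h7)
  have hc1 : (0 : ℝ) ≤ 1 + 4 / (l : ℝ) := by positivity
  have hc2 : (0 : ℝ) ≤ 4 / (l : ℝ) := by positivity
  have hc3 : (0 : ℝ) ≤ 20 / 3 * ((3 + Real.log E) / 4) := by positivity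
  refine mul_le_mul_of_nonneg_left ?_ hc0
  have t1 := mul_le_mul_of_nonneg_left hA hc1
  have t2 := mul_le_mul_of_nonneg_left hB hc2
  have t3 := mul_le_mul_of_nonneg_left hcard hc3
  linarith

/-- **Every datum has support ramification `≤ 184320·[F_tpd:ℚ]·l⁴`**: `e(K_{v̲}/ℚ_p) ≤ [K_{v̲} : ℚ_p] ≤ [K : ℚ]` (abc-iut-w6-d105) and
`[K : ℚ] ≤ 184320·[F_tpd:ℚ]·l⁴` for the `l`-division tower of a genuine datum (abc-iut-w5-d194, [IUTchIV] Thm. 1.10 Step (ii)).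
[cite: Mochizuki2012, IUTchIV Thm. 1.10 proof Step (ii) p. 24] [cite: NeukirchANT1999, Ch. I Prop. (8.2)] -/
theorem ramBound_of_datum (T : Cor22.ThetaVolumeDatumAt P l) :
    letI := T.instFieldF; letI := T.instNumberFieldF; letI := T.instAlgebraF; letI := T.instFieldK
    letI := T.instNumberFieldK; letI := T.instAlgebraK; letI := T.instIsElliptic
    ∀ (p : ℕ) [hp : Fact p.Prime], p ∈ T.I.supportPrimes → ∀ v : placesOver (fieldOfModuli T.E) p,
      absRamificationIdx p ((T.I.σ.localFieldFamily p hp.out).k v) ≤ 184320 * P.degree * l ^ 4 := by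
  letI := T.instFieldF; letI := T.instNumberFieldF; letI := T.instAlgebraF; letI := T.instFieldK
  letI := T.instNumberFieldK; letI := T.instAlgebraK; letI := T.instFieldFbar; letI := T.instAlgebraFbar
  letI := T.instAlgebraKFbar; letI := T.instIsElliptic
  intro p hp _ v
  have h1 : absRamificationIdx p ((T.I.σ.localFieldFamily p hp.out).k v) ≤ Module.finrank ℚ T.K :=
    absRamificationIdx_rescaledCompletion_le_finrank_rat T.K p (T.I.σ.lift v.1) (T.I.σ.natCast_mem_lift v)
  exact h1.trans T.finrank_rat_K_le

/-- **ALL DATA: `Cor312PerImageAtDatum P l` ⟹ Szpiro-type inequality**, support ramification bounded by `E`: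
`κ_l·log q^{∤2l} ≤ (l+1)/4·{(1+4/l)·(L + 2 log l + 21) + (4/l)·(2 d_mod L + log 30l) + (20/3)·((3 + log E)/4)·(E + 3)} + ((l+5)/4)·log π`.
[cite: Mochizuki2012, IUTchIV Thm. 1.10 proof Steps (v)–(x) p. 27–32] [claim: Mochizuki2012, status: disputed] -/
theorem szpiro_of_cor312PerImageAtDatum_ofRamBound (hP : P ∈ UP) (h7 : 7 ≤ l) (h : Cor22.Cor312PerImageAtDatum P l)
    (T : Cor22.ThetaVolumeDatumAt P l) (E : ℕ) (hE1 : 1 ≤ E)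
    (hE : letI := T.instFieldF; letI := T.instNumberFieldF; letI := T.instAlgebraF; letI := T.instFieldK
      letI := T.instNumberFieldK; letI := T.instAlgebraK; letI := T.instIsElliptic
      ∀ (p : ℕ) [hp : Fact p.Prime], p ∈ T.I.supportPrimes → ∀ v : placesOver (fieldOfModuli T.E) p,
        absRamificationIdx p ((T.I.σ.localFieldFamily p hp.out).k v) ≤ E) :
    (((l : ℝ) + 1) / 24 - 1 / (2 * l)) * Cor22.logQAvoid P {2, l} ≤
      ((l : ℝ) + 1) / 4 *
        ((1 + 4 / (l : ℝ)) * (P.logDiff + Cor22.logCondAvoid P {2, l} + 2 * Real.log l + 21)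
          + 4 / (l : ℝ) * (2 * (Cor22.dmod P : ℝ) * (P.logDiff + Cor22.logCondAvoid P {2, l}) + Real.log (2 * 3 * 5 * (l : ℝ)))
          + 20 / 3 * ((3 + Real.log E) / 4) * ((E : ℝ) + 3))
      + ThetaVolumeInput.archLogTheta l := by
  rw [← gap_eq T hP.1]
  exact T.gap_le_perImage (h T) (hullEstimatePerImageOf_ofRamBound T hP h7 E hE1 hE)

/-- **ALL DATA, SZPIRO FORM WITH CONSTANT `→ 6`** (support ramification `≤ E`): `Cor312PerImageAtDatum P l ⟹
(1/6 − 2/(l(l+1)))·log q^{∤2l}(λ) ≤ (1 + (4 + 8 d_mod)/l)·L + 5 log l + 46 + 2 log π + (5/3)·(3 + log E)·(E + 3)`.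
[cite: Mochizuki2012, IUTchIV Thm. 1.10 p. 22–23] [claim: Mochizuki2012, status: disputed] -/
theorem szpiro_of_cor312PerImageAtDatum_six_ofRamBound (hP : P ∈ UP) (h7 : 7 ≤ l) (h : Cor22.Cor312PerImageAtDatum P l)
    (T : Cor22.ThetaVolumeDatumAt P l) (E : ℕ) (hE1 : 1 ≤ E)
    (hE : letI := T.instFieldF; letI := T.instNumberFieldF; letI := T.instAlgebraF; letI := T.instFieldK
      letI := T.instNumberFieldK; letI := T.instAlgebraK; letI := T.instIsElliptic
      ∀ (p : ℕ) [hp : Fact p.Prime], p ∈ T.I.supportPrimes → ∀ v : placesOver (fieldOfModuli T.E) p,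
        absRamificationIdx p ((T.I.σ.localFieldFamily p hp.out).k v) ≤ E) :
    (1 / 6 - 2 / ((l : ℝ) * ((l : ℝ) + 1))) * Cor22.logQAvoid P {2, l} ≤
      (1 + (4 + 8 * (Cor22.dmod P : ℝ)) / l) * (P.logDiff + Cor22.logCondAvoid P {2, l})
        + 5 * Real.log l + 46 + 2 * Real.log Real.pi + 5 / 3 * (3 + Real.log E) * ((E : ℝ) + 3) := by
  have hmain := szpiro_of_cor312PerImageAtDatum_ofRamBound hP h7 h T E hE1 hE
  have hl7 : (7 : ℝ) ≤ l := by exact_mod_cast h7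
  have hl0 : (0 : ℝ) < l := by linarith
  have harch : ThetaVolumeInput.archLogTheta l = ((l : ℝ) + 5) / 4 * Real.log Real.pi := rfl
  rw [harch] at hmain
  set L : ℝ := P.logDiff + Cor22.logCondAvoid P {2, l} with hLdef
  set D : ℝ := (Cor22.dmod P : ℝ) with hDdef
  set X : ℝ := Real.log (2 * 3 * 5 * (l : ℝ)) with hXdef
  set W : ℝ := 5 / 3 * (3 + Real.log E) * ((E : ℝ) + 3) with hWdef
  have hE1R : (1 : ℝ) ≤ E := by exact_mod_cast hE1
  have hlogE : 0 ≤ Real.log E := Real.log_nonneg hE1R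
  have hW0 : 0 ≤ W := by rw [hWdef]; positivity
  have hWeq : 20 / 3 * ((3 + Real.log E) / 4) * ((E : ℝ) + 3) = W := by rw [hWdef]; ring
  rw [hWeq] at hmain
  have hL0 : 0 ≤ L := add_nonneg P.logDiff_nonneg (Cor22.logCondAvoid_nonneg P _)
  have hD0 : 0 ≤ D := by rw [hDdef]; positivity
  have hlogl : 0 ≤ Real.log l := Real.log_nonneg (by linarith)
  have hpi0 : 0 ≤ Real.log Real.pi := Real.log_nonneg (by linarith [Real.pi_gt_three])
  have hX0 : 0 ≤ X := Real.log_nonneg (by linarith)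
  have hX : X ≤ 4 + Real.log l := by
    have h32 : Real.log (2 * 3 * 5 * (l : ℝ)) ≤ Real.log ((2 : ℝ) ^ 5 * (l : ℝ)) :=
      Real.log_le_log (by positivity) (by nlinarith)
    have e : Real.log ((2 : ℝ) ^ 5 * (l : ℝ)) = 5 * Real.log 2 + Real.log l := by
      rw [Real.log_mul (by positivity) (by positivity), Real.log_pow]; push_cast; ring
    have h2 : Real.log 2 ≤ 0.6931471808 := Real.log_two_lt_d9.le
    linarith
  -- multiply the gap inequality by `4/(l+1)`
  have hl1 : (0 : ℝ) < (l : ℝ) + 1 := by linarith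
  have key : (4 / ((l : ℝ) + 1)) * ((((l : ℝ) + 1) / 24 - 1 / (2 * l)) * Cor22.logQAvoid P {2, l}) ≤
      (4 / ((l : ℝ) + 1)) * (((l : ℝ) + 1) / 4 * ((1 + 4 / (l : ℝ)) * (L + 2 * Real.log l + 21)
        + 4 / (l : ℝ) * (2 * D * L + X) + W) + ((l : ℝ) + 5) / 4 * Real.log Real.pi) :=
    mul_le_mul_of_nonneg_left hmain (by positivity)
  have hQ0 : 0 ≤ Cor22.logQAvoid P {2, l} := Cor22.logQAvoid_nonneg P _
  have e1 : (4 / ((l : ℝ) + 1)) * ((((l : ℝ) + 1) / 24 - 1 / (2 * l)) * Cor22.logQAvoid P {2, l}) =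
      (1 / 6 - 2 / ((l : ℝ) * ((l : ℝ) + 1))) * Cor22.logQAvoid P {2, l} := by
    field_simp
    ring
  have e2 : (4 / ((l : ℝ) + 1)) * (((l : ℝ) + 1) / 4 * ((1 + 4 / (l : ℝ)) * (L + 2 * Real.log l + 21)
        + 4 / (l : ℝ) * (2 * D * L + X) + W) + ((l : ℝ) + 5) / 4 * Real.log Real.pi) =
      (1 + 4 / (l : ℝ)) * (L + 2 * Real.log l + 21) + 4 / (l : ℝ) * (2 * D * L + X) + W
        + ((l : ℝ) + 5) / ((l : ℝ) + 1) * Real.log Real.pi := by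
    field_simp
  rw [e1, e2] at key
  -- `(l+5)/(l+1) ≤ 2`, `(1+4/l)(2 log l + 21) + (4/l)·X ≤ 5 log l + 46` for `l ≥ 7`
  have hpi : ((l : ℝ) + 5) / ((l : ℝ) + 1) * Real.log Real.pi ≤ 2 * Real.log Real.pi := by
    have : ((l : ℝ) + 5) / ((l : ℝ) + 1) ≤ 2 := by
      rw [div_le_iff₀ hl1]; linarith
    exact mul_le_mul_of_nonneg_right this hpi0
  have h4l : 4 / (l : ℝ) ≤ 4 / 7 := by
    apply div_le_div_of_nonneg_left (by norm_num) (by norm_num) hl7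
  have hconst : (1 + 4 / (l : ℝ)) * (2 * Real.log l + 21) + 4 / (l : ℝ) * X ≤ 5 * Real.log l + 46 := by
    have a1 : (1 + 4 / (l : ℝ)) * (2 * Real.log l + 21) ≤ (1 + 4 / 7) * (2 * Real.log l + 21) := by
      apply mul_le_mul_of_nonneg_right _ (by positivity); linarith
    have a2 : 4 / (l : ℝ) * X ≤ 4 / 7 * (4 + Real.log l) :=
      mul_le_mul h4l hX hX0 (by norm_num)
    nlinarith
  have hmainL : (1 + 4 / (l : ℝ)) * (L + 2 * Real.log l + 21) + 4 / (l : ℝ) * (2 * D * L + X) =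
      (1 + (4 + 8 * D) / l) * L + ((1 + 4 / (l : ℝ)) * (2 * Real.log l + 21) + 4 / (l : ℝ) * X) := by
    field_simp
    ring
  rw [hmainL] at key
  linarith

/-- **ALL DATA, UNCONDITIONALLY IN THE DATUM**: for `P ∈ UP`, a prime `l ≥ 7` and ANY genuine Θ-volume datum `T` at `(P, l)`,
`Cor312PerImageAtDatum P l ⟹ (1/6 − 2/(l(l+1)))·log q^{∤2l}(λ) ≤ (1 + (4 + 8 d_mod)/l)·(log-diff + log 𝔣^{∤2l}) + 5 log l + 46 + 2 log π
+ (5/3)·(3 + log E₀)·(E₀ + 3)` with `E₀ = 184320·[F_tpd:ℚ]·l⁴` — Szpiro with constant `→ 6` and an additive term polynomial in `l`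
(print: `(1 + 20 d_mod/l)·L + 20·(d*_mod·l + η)`). Replaces this lineage's vacuous `…_tame_six` (p437841). No side taken on the crux.
[cite: Mochizuki2012, IUTchIV Thm. 1.10 p. 22–23; proof Steps (ii)–(x) p. 24–32] [claim: Mochizuki2012, status: disputed] -/
theorem szpiro_of_cor312PerImageAtDatum_six_all (hP : P ∈ UP) (h7 : 7 ≤ l) (h : Cor22.Cor312PerImageAtDatum P l)
    (T : Cor22.ThetaVolumeDatumAt P l) :
    (1 / 6 - 2 / ((l : ℝ) * ((l : ℝ) + 1))) * Cor22.logQAvoid P {2, l} ≤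
      (1 + (4 + 8 * (Cor22.dmod P : ℝ)) / l) * (P.logDiff + Cor22.logCondAvoid P {2, l})
        + 5 * Real.log l + 46 + 2 * Real.log Real.pi
        + 5 / 3 * (3 + Real.log ((184320 * P.degree * l ^ 4 : ℕ) : ℝ)) * (((184320 * P.degree * l ^ 4 : ℕ) : ℝ) + 3) := by
  have hdeg : 1 ≤ P.degree := Module.finrank_pos
  have hl1 : 1 ≤ l := le_trans (by norm_num) h7
  have hE1 : 1 ≤ 184320 * P.degree * l ^ 4 :=
    Nat.one_le_iff_ne_zero.mpr (by positivity)
  exact szpiro_of_cor312PerImageAtDatum_six_ofRamBound hP h7 h T _ hE1 (ramBound_of_datum T)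

end PointDict

end Summit.ABC.IUTFork

/-! ## The non-vacuous sandwich at `d_mod = 1` -/

namespace Literature.IUT.LogVolume.Cor22

open Literature.NumberTheory.DiophantineGeometry.GenEll Summit.ABC.IUTFork Literature.IUT.HodgeTheaters

variable {P : NFPoint} {l : ℕ}

/-- **THE SANDWICH AT `d_mod = 1`, BOTH HALVES NON-VACUOUS** (supersedes `cor312PerImageAtDatum_sandwich_dmod_one`, whose second half
carries the unsatisfiable «tame» hypothesis of p437841): for `λ ∈ U_X` minimally presented with `j(λ) ∈ ℚ` and a prime `l ≥ 7`:
(⇐) `log q^{∤2l} ≤ (6l(l+1)/((l+4)(l−3)))·(log-diff + (1 − 1/l)·log-cond) + (6l(l+5)/((l+4)(l−3)))·log π ⟹ Cor312PerImageAtDatum P l` (p446147);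
(⇒) `Cor312PerImageAtDatum P l ⟹` at ANY genuine datum `T` of `(P, l)`:
`(1/6 − 2/(l(l+1)))·log q^{∤2l} ≤ (1 + 12/l)·(log-diff + log-cond) + 5·log l + 46 + 2·log π + (5/3)·(3 + log E₀)·(E₀ + 3)`, `E₀ = 184320·[F_tpd:ℚ]·l⁴`.
Both Szpiro constants tend to `6`; the additive terms are explicit. No side taken on which holds at any given point.
[cite: Mochizuki2012, IUTchIII Cor. 3.12 p. 173–174; IUTchIV Thm. 1.10 p. 22–23] [claim: Mochizuki2012, status: disputed] -/
theorem cor312PerImageAtDatum_sandwich_dmod_one_all (hP : P ∈ UP) (h7 : 7 ≤ l) (hd : dmod P = 1) :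
    (logQAvoid P {2, l} ≤
        6 * l * ((l : ℝ) + 1) / (((l : ℝ) + 4) * ((l : ℝ) - 3))
            * (P.logDiff + (1 - 1 / (l : ℝ)) * logCondAvoid P {2, l})
          + 6 * l * ((l : ℝ) + 5) / (((l : ℝ) + 4) * ((l : ℝ) - 3)) * Real.log Real.pi →
      Cor312PerImageAtDatum P l) ∧
    (Cor312PerImageAtDatum P l → ∀ T : ThetaVolumeDatumAt P l,
      (1 / 6 - 2 / ((l : ℝ) * ((l : ℝ) + 1))) * logQAvoid P {2, l} ≤
        (1 + 12 / (l : ℝ)) * (P.logDiff + logCondAvoid P {2, l}) + 5 * Real.log l + 46 + 2 * Real.log Real.pi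
          + 5 / 3 * (3 + Real.log ((184320 * P.degree * l ^ 4 : ℕ) : ℝ)) * (((184320 * P.degree * l ^ 4 : ℕ) : ℝ) + 3)) := by
  refine ⟨fun h => cor312PerImageAtDatum_of_szpiroSix hP.1 (by omega) hd h, fun h T => ?_⟩
  have hmain := PointDict.szpiro_of_cor312PerImageAtDatum_six_all hP h7 h T
  have hdR : (dmod P : ℝ) = 1 := by exact_mod_cast hd
  rw [hdR] at hmain
  have e : (4 + 8 * (1 : ℝ)) = 12 := by norm_num
  rw [e] at hmain
  exact hmain

end Literature.IUT.LogVolume.Cor22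

end
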